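import Mathlib
import HarnessLib
import Summits.ValiantsHypothesis.ValiantsHypothesis.Theses.ValuativeGCT
import Literature.Computability.AlgebraicComplexity.OrbitClosureWeights
import Literature.Computability.Complexity.OccurrenceObstructionsIPProofs

/-!
# Siege stubs for crux `ValuativeGCT.ValuativeFlip` (stmt-ValiantsHypothesis-12624)

Wall-breaker planner (`siege-plan`, planner-sgplan-stmt-ValiantsHypothesis-12624-wall-plan-0,
2026-08-16).  Companion of `Cruxes/ValuativeFlip/DECOMPOSITIONS.md`.  This file is NOT a
replacement skeleton (the active skeleton stays the strategist's `Lines/four_row_count.lean`,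
sha 90e1bc66…, whose five stubs remain registered); it carries

* the two intermediate statements REGISTERED as stubs on the crux by this seat
  (`ledger workitem stub-add`), stated here so that they are seen to elaborate —
  `stub_evalRankLowerBound` (per-side ENGINE: a nonsingular evaluation matrix of highest-weight
  vectors at points `A · f`, `A ∈ End`, is a multiplicity lower bound on the SINGLE orbit closure
  `Δ_m(f)`) and `stub_twistedInheritance` (the Kadish–Landsberg lift run INSIDE the padded orbit
  closure: a Δ_j-twisted inner certificate at size `n` bounds the padded-permanent multiplicity at
  `μ♯(n+j)` from below, for EVERY padding `j` — the provable replacement of the dead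
  `stub_perAnchorInheritance` = BLMW 2011 Problem 6.10);
* and, sorry-free over stubs, how they feed the crux: the TAIL of the window asks for per-side
  certificate families of one of the two kinds (`stub_tailCertificates`, OPEN = sub-crux `TailFlip`
  with the padded-permanent multiplicity replaced by a certificate), the two engines turn either
  kind into `mult_pp > dim T_U`, and with the HEAD (`stub_headFlip` = sub-crux `HeadFlip(6/5)`, the
  output of line `four-row-count`) the split glue of `Split.lean` gives
  `ValuativeFlip_of : ValuativeGCT.ValuativeFlip` by name.

Sorries live only in `stub_*`.  [this crux: Lines/four_row_count.lean, Split.lean,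
DrefuteG2StubPerAnchorInheritance.md §3(iii)/§4; arXiv:1512.03798 Prop. 2.6(b);
BurgisserIkenmeyerPanovaJAMS2019 Lemma 5.2, Thm 5.4; arXiv:0907.2850 §6.4 Problem 6.10;
MulmuleySohoni2001 §4–5]
-/

set_option linter.dupNamespace false
set_option maxHeartbeats 800000

namespace Summit.ValiantsHypothesis.ValiantsHypothesis.Cruxes.ValuativeFlip.SiegeStubs

open MvPolynomial
open scoped BigOperators Matrix
open Literature.NumberTheory.DiophantineGeometry
open Literature.Computability.AlgebraicComplexity
open Literature.Computability.Complexity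

noncomputable section

/-! ## Registered stub 1 — the evaluation certificate (per-side engine; axes P-explicit, P-tables) -/

/-- **stub_evalRankLowerBound** (provable now, size S–M).  Let `f` be any polynomial in the
variables `σ`, `m ≠ 0`, `χ` a weight, `F₁ … F_D` highest-weight vectors of weight `χ` in the
polynomial ring `ℂ[Sym^m ℂ^σ]` on coefficient space (`coordRep σ ℂ m`), and `A₁ … A_D` ANY
matrices (singular allowed).  If the evaluation matrix `(F_i(A_l · f))_{i,l}` is nonsingular, then
`D ≤ mult_χ ℂ[Δ_m(f)]` (`orbitMultiplicity ℂ f m χ`).  Proof route: the classes of the `F_i` in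
`ℂ[Δ_m(f)] = ℂ[Sym^m] ⧸ I(GL·f)` are highest-weight vectors of weight `χ` (the quotient map is
equivariant, `mkₐ_comp_coordRep`); a vanishing linear combination `G = Σ cᵢ Fᵢ ∈ I(GL·f)` lies in
the kernel of the generic orbit map (`orbitVanishingIdeal_eq_ker_genericOrbitMap`), hence
`G(A · f) = 0` for EVERY matrix `A` (`eval_genericOrbitMap`), so `c = 0` by nonsingularity; the
highest-weight space is finite-dimensional for `m ≠ 0`
(`finiteDimensional_highestWeightSpace_orbitCoordRep_holds`).  This is the landing spot of every
explicit or computed padded-permanent highest-weight-vector family: a certificate is ONE nonzero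
determinant (integer points + integer tableau functions ⇒ certifiable by a nonzero residue mod p).
[MulmuleySohoni2001 §4–5; BLMW2011 §5.2; arXiv:1911.03990 §3 (evaluating HWVs at points);
this crux DrefuteG2Census.md (method)] -/
theorem stub_evalRankLowerBound :
    ∀ {σ : Type} [Fintype σ] [LinearOrder σ] (f : MvPolynomial σ ℂ) (m : ℕ), m ≠ 0 →
      ∀ (χ : Weight σ) (D : ℕ) (F : Fin D → MvPolynomial (DegIdx σ m) ℂ),
        (∀ i, F i ∈ highestWeightSpace (coordRep σ ℂ m) χ) →
        ∀ (A : Fin D → Matrix σ σ ℂ),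
          (Matrix.of fun i l : Fin D => MvPolynomial.aeval (formCoeff m (linSubst σ ℂ (A l) f)) (F i)).det ≠ 0 →
          D ≤ orbitMultiplicity ℂ f m χ := by
  sorry

/-! ## Registered stub 2 — twisted inheritance (per-side transport along the padding; axes P-explicit, S) -/

/-- **stub_twistedInheritance** (provable now from tree pieces, size M–L).  For inner size `n`,
padding `j`, degree `δ`, an inner shape `μ ⊢ nδ` with `≤ n²` parts, highest-weight vectors
`F₁ … F_D` of weight `μ*` (`partitionWeightLex n μ`) on `ℂ[Sym^n ℂ^{n²}]`, and matrices
`A₁ … A_D ∈ Mat_{n²}`: if the Δ_j-TWISTED evaluation matrix `(F_i(Δ_j (A_l · per_n)))_{i,l}` is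
nonsingular — `Δ_j` rescales the coefficient of the monomial `x^e` by `(e_top + j)!/e_top!`,
`e_top` = exponent of the greatest variable `topMatIdx n`, exactly the factor of
`aeval_formCoeff_paddedForm_liftHWV` — then `D ≤ mult_{(μ♯(n+j))*} ℂ[Δ_{n+j}(X₀₀^j per_n)]`, the
multiplicity of `partitionWeightLex (n+j) (rowLift μ j)` in the coordinate ring of the orbit
closure of the ROUTE's padded permanent `paddedPerFormLex ℂ n (n+j)` (`per_n = paddedPerFormLex ℂ n n`).
Proof route: lift `F_i ↦ liftHWV n j F_i` (highest-weight vectors of weight `(μ♯)*`,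
`liftHWV_mem_highestWeightSpace`); the padded inner points `X_top^j · (A_l · per_n)(segment)`
(`paddedForm n j (linSubst A_l per_n)`) are `Ã_l · pp` for explicit `Ã_l ∈ End(ℂ^{(n+j)²})`
(`X₀₀ ↦ X_top`, bottom-right block onto the final segment through `A_l`, `paddedPerFormLex_eq`);
by `aeval_formCoeff_paddedForm_liftHWV` the evaluation matrix of the lifts at the points `Ã_l · pp`
IS the twisted inner matrix; conclude by `stub_evalRankLowerBound`.  This is the "≥" half of BLMW
Problem 6.10 in its PROVABLE, twisted form (DrefuteG2StubPerAnchorInheritance.md §3(iii), §4):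
untwisted inheritance `P_n(μ) ≤ mult_pp(μ♯)` stays open; the twisted anchor
`rank{(F∘Δ_j)|_{End·per_n}}` is a lower bound at every `j`, computable at inner size `n`.
[arXiv:1512.03798 Prop. 2.6(b) (held Prop. 13(b)); arXiv:1204.4693 §2; BurgisserIkenmeyerPanovaJAMS2019
Lemma 5.2, Thm 5.4; arXiv:0907.2850 §6.4 Problem 6.10; tree `plethysmCoeff_le_orbitMultiplicity_rowLift`] -/
theorem stub_twistedInheritance :
    ∀ (n j δ : ℕ) [NeZero n] [NeZero (n + j)] (μ : Nat.Partition (n * δ)), μ.parts.card ≤ n * n →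
      ∀ (D : ℕ) (F : Fin D → MvPolynomial (DegIdx (MatIdx n) n) ℂ),
        (∀ i, F i ∈ highestWeightSpace (coordRep (MatIdx n) ℂ n) (partitionWeightLex n μ)) →
        ∀ (A : Fin D → Matrix (MatIdx n) (MatIdx n) ℂ),
          (Matrix.of fun i l : Fin D => MvPolynomial.aeval
              (fun e : DegIdx (MatIdx n) n =>
                (((e.1 (topMatIdx n) + j).descFactorial j : ℕ) : ℂ) *
                  MvPolynomial.coeff e.1 (linSubst (MatIdx n) ℂ (A l) (paddedPerFormLex ℂ n n)))
              (F i)).det ≠ 0 →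
          D ≤ orbitMultiplicity ℂ (paddedPerFormLex ℂ n (n + j)) (n + j) (partitionWeightLex (n + j) (rowLift μ j)) := by
  sorry

/-! ## The tail as certificate families (OPEN) and the head (= line four-row-count) -/

/-- **stub_tailCertificates** — THE TAIL OF THE WINDOW, per side in certificate currency (OPEN;
= the strategist's sub-crux `TailFlip` with the padded-permanent multiplicity replaced by a
certificate that one of the two engines converts).  For every slope `a/b > 1` and every `c`,
eventually in `n`, at every window position `m = n + j` above the linear head, EITHER
(twisted / inner kind) there are a degree `δ`, an inner shape `μ ⊢ nδ` (`≤ n²` parts), inner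
highest-weight vectors `F` and inner points `A` with nonsingular Δ_j-twisted evaluation matrix of
size `D`, and an admissible centre `(U, r)` whose valuative truncation at the padded shape
`μ♯(n+j)` (the crux's `T`, verbatim, size `n+j`) has dimension `< D`; OR (outer kind) the same with
a shape `λ ⊢ (n+j)δ` (`≤ (n+j)²` parts), highest-weight vectors of weight `λ*` on
`ℂ[Sym^{n+j} ℂ^{(n+j)²}]` and points `A ∈ Mat_{(n+j)²}` evaluated at `A · (X₀₀^j per_n)` directly.
Why this is the right residual: the per side becomes a finite certificate (no Problem 6.10, no
Γ-variety), every occurring shape of the main family is `μ♯m` (Kadish–Landsberg), and what stays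
unknown is isotypic — which shapes of GROWING length keep a certificate above the det-side census
(bounded length dies at `m ≥ 1 + n(n+1)^ℓ`, `orbitMultiplicity_paddedPer_le_det_of_card_parts`;
`≤ 3` rows never flip; total counts lose beyond `√2·n`).  Honest label: OPEN, conjecture-grade
(sandwiched like `TailFlip`: `GctKroneckerFlip ⇒ · ⇒ GctMultFlip` on its range).
[this crux STRATEGY-CENSUS.md §Decomposition; arXiv:1204.4693 Thm 1.2; Bläser–Ikenmeyer 2025 §12.4] -/
theorem stub_tailCertificates :
    ∀ a b : ℕ, b < a → ∀ c : ℕ, ∃ n₀ : ℕ, ∀ n ≥ n₀, ∀ (j : ℕ) [NeZero n] [NeZero (n + j)],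
      a * n < b * (n + j) → n + j ≤ 2 ^ ((Nat.log 2 n + c) ^ c) →
      (∃ (δ : ℕ) (μ : Nat.Partition (n * δ)) (D : ℕ) (F : Fin D → MvPolynomial (DegIdx (MatIdx n) n) ℂ)
        (A : Fin D → Matrix (MatIdx n) (MatIdx n) ℂ) (U : Submodule ℂ (MatIdx (n + j) → ℂ)) (r : ℕ),
        μ.parts.card ≤ n * n ∧
        (∀ i, F i ∈ highestWeightSpace (coordRep (MatIdx n) ℂ n) (partitionWeightLex n μ)) ∧
        (Matrix.of fun i l : Fin D => MvPolynomial.aeval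
            (fun e : DegIdx (MatIdx n) n =>
              (((e.1 (topMatIdx n) + j).descFactorial j : ℕ) : ℂ) *
                MvPolynomial.coeff e.1 (linSubst (MatIdx n) ℂ (A l) (paddedPerFormLex ℂ n n)))
            (F i)).det ≠ 0 ∧
        (∀ u ∈ U, (Matrix.of fun a b : Fin (n + j) => u (toLex (a, b))).rank ≤ r) ∧
        Module.finrank ℂ ↥(MvPolynomial.homogeneousSubmodule (MatIdx (n + j) × MatIdx (n + j)) ℂ ((n + j) * δ) ⊓
            ((MvPolynomial.vanishingIdeal ℂ {p : MatIdx (n + j) × MatIdx (n + j) → ℂ | ∀ j' : MatIdx (n + j), (fun i => p (j', i)) ∈ U}) ^ (δ * ((n + j) - r))).restrictScalars ℂ ⊓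
            (⨅ (M : Matrix (MatIdx (n + j)) (MatIdx (n + j)) ℂ) (_ : linSubst (MatIdx (n + j)) ℂ M (detFormLex ℂ (n + j)) = detFormLex ℂ (n + j)),
              LinearMap.ker ((MvPolynomial.aeval (R := ℂ) fun p : MatIdx (n + j) × MatIdx (n + j) => ∑ l : MatIdx (n + j), M l p.2 • MvPolynomial.X (p.1, l)).toLinearMap -
                LinearMap.id (R := ℂ) (M := MvPolynomial (MatIdx (n + j) × MatIdx (n + j)) ℂ))) ⊓
            (⨅ (g : Matrix.GeneralLinearGroup (MatIdx (n + j)) ℂ) (_ : IsUpperTriangular g),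
              LinearMap.ker ((MvPolynomial.aeval (R := ℂ) fun p : MatIdx (n + j) × MatIdx (n + j) => ∑ l : MatIdx (n + j), ((g⁻¹ : Matrix.GeneralLinearGroup (MatIdx (n + j)) ℂ) : Matrix (MatIdx (n + j)) (MatIdx (n + j)) ℂ) p.1 l • MvPolynomial.X (l, p.2)).toLinearMap -
                weightChar (partitionWeightLex (n + j) (rowLift μ j)) g • LinearMap.id (R := ℂ) (M := MvPolynomial (MatIdx (n + j) × MatIdx (n + j)) ℂ)))) < D) ∨
      (∃ (δ : ℕ) (lam : Nat.Partition ((n + j) * δ)) (D : ℕ) (F : Fin D → MvPolynomial (DegIdx (MatIdx (n + j)) (n + j)) ℂ)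
        (A : Fin D → Matrix (MatIdx (n + j)) (MatIdx (n + j)) ℂ) (U : Submodule ℂ (MatIdx (n + j) → ℂ)) (r : ℕ),
        lam.parts.card ≤ (n + j) * (n + j) ∧
        (∀ i, F i ∈ highestWeightSpace (coordRep (MatIdx (n + j)) ℂ (n + j)) (partitionWeightLex (n + j) lam)) ∧
        (Matrix.of fun i l : Fin D => MvPolynomial.aeval
            (formCoeff (n + j) (linSubst (MatIdx (n + j)) ℂ (A l) (paddedPerFormLex ℂ n (n + j)))) (F i)).det ≠ 0 ∧
        (∀ u ∈ U, (Matrix.of fun a b : Fin (n + j) => u (toLex (a, b))).rank ≤ r) ∧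
        Module.finrank ℂ ↥(MvPolynomial.homogeneousSubmodule (MatIdx (n + j) × MatIdx (n + j)) ℂ ((n + j) * δ) ⊓
            ((MvPolynomial.vanishingIdeal ℂ {p : MatIdx (n + j) × MatIdx (n + j) → ℂ | ∀ j' : MatIdx (n + j), (fun i => p (j', i)) ∈ U}) ^ (δ * ((n + j) - r))).restrictScalars ℂ ⊓
            (⨅ (M : Matrix (MatIdx (n + j)) (MatIdx (n + j)) ℂ) (_ : linSubst (MatIdx (n + j)) ℂ M (detFormLex ℂ (n + j)) = detFormLex ℂ (n + j)),
              LinearMap.ker ((MvPolynomial.aeval (R := ℂ) fun p : MatIdx (n + j) × MatIdx (n + j) => ∑ l : MatIdx (n + j), M l p.2 • MvPolynomial.X (p.1, l)).toLinearMap -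
                LinearMap.id (R := ℂ) (M := MvPolynomial (MatIdx (n + j) × MatIdx (n + j)) ℂ))) ⊓
            (⨅ (g : Matrix.GeneralLinearGroup (MatIdx (n + j)) ℂ) (_ : IsUpperTriangular g),
              LinearMap.ker ((MvPolynomial.aeval (R := ℂ) fun p : MatIdx (n + j) × MatIdx (n + j) => ∑ l : MatIdx (n + j), ((g⁻¹ : Matrix.GeneralLinearGroup (MatIdx (n + j)) ℂ) : Matrix (MatIdx (n + j)) (MatIdx (n + j)) ℂ) p.1 l • MvPolynomial.X (l, p.2)).toLinearMap -
                weightChar (partitionWeightLex (n + j) lam) g • LinearMap.id (R := ℂ) (M := MvPolynomial (MatIdx (n + j) × MatIdx (n + j)) ℂ)))) < D) := by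
  sorry

/-- **stub_headFlip** — THE LINEAR HEAD OF THE WINDOW with slope `6/5` (= sub-crux `HeadFlip`,
verbatim the conclusion of `headFlipBody_of` of line `four-row-count`, which derives it sorry-free
from its four head stubs `stub_fourRowSliceBound`, `stub_fourRowPencilRank`,
`stub_fourRowHilbertLowerBound`, `stub_fourRowBridge`, all registered on the crux).  Not
registered again by this seat.  [this crux Lines/four_row_count.lean] -/
theorem stub_headFlip :
    ∃ n₀ : ℕ, ∀ n ≥ n₀, ∀ (m : ℕ) [NeZero m], n ≤ m → 5 * m ≤ 6 * n →
      ∃ (U : Submodule ℂ (MatIdx m → ℂ)) (r δ : ℕ) (lam : Nat.Partition (m * δ)), (∀ u ∈ U, (Matrix.of fun a b : Fin m => u (toLex (a, b))).rank ≤ r) ∧ lam.parts.card ≤ m * m ∧ (let χ : Weight (MatIdx m) := (Weight.dualOfPartition (m * m) lam).toMatIdx; let T : Submodule ℂ (MvPolynomial (MatIdx m × MatIdx m) ℂ) := MvPolynomial.homogeneousSubmodule (MatIdx m × MatIdx m) ℂ (m * δ) ⊓ ((MvPolynomial.vanishingIdeal ℂ {p : MatIdx m × MatIdx m → ℂ |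 ∀ j : MatIdx m, (fun i => p (j, i)) ∈ U}) ^ (δ * (m - r))).restrictScalars ℂ ⊓ (⨅ (M : Matrix (MatIdx m) (MatIdx m) ℂ) (_ : linSubst (MatIdx m) ℂ M (detFormLex ℂ m) = detFormLex ℂ m), LinearMap.ker ((MvPolynomial.aeval (R := ℂ) fun p : MatIdx m × MatIdx m => ∑ l : MatIdx m, M l p.2 • MvPolynomial.X (p.1, l)).toLinearMap - LinearMap.id (R := ℂ) (M := MvPolynomial (MatIdx m × MatIdx m) ℂ))) ⊓ (⨅ (g : Matrix.GeneralLinearGroup (MatIdx m) ℂ) (_ : IsUpperTriangular g), LinearMap.ker ((MvPolynomial.aeval (R := ℂ) fun p : MatIdx m × MatIdx m => ∑ l : MatIdx m, ((g⁻¹ : Matrix.GeneralLinearGroup (MatIdx m) ℂ) : Matrix (MatIdx m) (MatIdx m) ℂ) p.1 l • MvPolynomial.X (l, p.2)).toLinearMap - weightChar χ g • LinearMap.id (R := ℂ) (M := MvPolynomial (MatIdx m × MatIdx m) ℂ))); Module.finrank ℂ ↥T < orbitMultiplicity ℂ (paddedPerFormLex ℂ n m) m χ) := by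
  sorry

/-! ## Glue (sorry-free over the stubs) -/

/-- `b < a` and `a·n < b·m` force `n < m`. [folklore] -/
theorem lt_of_slope {a b n m : ℕ} (hba : b < a) (h : a * n < b * m) : n < m := by
  rcases lt_or_ge n m with hlt | hge
  · exact hlt
  · exfalso
    have h1 : b * m ≤ b * n := Nat.mul_le_mul_left b hge
    have h2 : b * n ≤ a * n := Nat.mul_le_mul_right n hba.le
    omega

/-- **The tail from the two engines and the certificate families** (= sub-crux `TailFlip` in the
shape of `Split.lean`): at `m = n + j` above the head, a certificate of size `D` above
`dim T_U(shape)` is put below the padded-permanent multiplicity by `stub_twistedInheritance`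
(inner kind) or `stub_evalRankLowerBound` (outer kind).  Sorry-free over the three stubs. [this file] -/
theorem tailFlip_of_certificates
    (hA : ∀ {σ : Type} [Fintype σ] [LinearOrder σ] (f : MvPolynomial σ ℂ) (m : ℕ), m ≠ 0 →
      ∀ (χ : Weight σ) (D : ℕ) (F : Fin D → MvPolynomial (DegIdx σ m) ℂ),
        (∀ i, F i ∈ highestWeightSpace (coordRep σ ℂ m) χ) →
        ∀ (A : Fin D → Matrix σ σ ℂ),
          (Matrix.of fun i l : Fin D => MvPolynomial.aeval (formCoeff m (linSubst σ ℂ (A l) f)) (F i)).det ≠ 0 →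
          D ≤ orbitMultiplicity ℂ f m χ)
    (hB : ∀ (n j δ : ℕ) [NeZero n] [NeZero (n + j)] (μ : Nat.Partition (n * δ)), μ.parts.card ≤ n * n →
      ∀ (D : ℕ) (F : Fin D → MvPolynomial (DegIdx (MatIdx n) n) ℂ),
        (∀ i, F i ∈ highestWeightSpace (coordRep (MatIdx n) ℂ n) (partitionWeightLex n μ)) →
        ∀ (A : Fin D → Matrix (MatIdx n) (MatIdx n) ℂ),
          (Matrix.of fun i l : Fin D => MvPolynomial.aeval
              (fun e : DegIdx (MatIdx n) n =>
                (((e.1 (topMatIdx n) + j).descFactorial j : ℕ) : ℂ) *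
                  MvPolynomial.coeff e.1 (linSubst (MatIdx n) ℂ (A l) (paddedPerFormLex ℂ n n)))
              (F i)).det ≠ 0 →
          D ≤ orbitMultiplicity ℂ (paddedPerFormLex ℂ n (n + j)) (n + j) (partitionWeightLex (n + j) (rowLift μ j)))
    (hC : ∀ a b : ℕ, b < a → ∀ c : ℕ, ∃ n₀ : ℕ, ∀ n ≥ n₀, ∀ (j : ℕ) [NeZero n] [NeZero (n + j)],
      a * n < b * (n + j) → n + j ≤ 2 ^ ((Nat.log 2 n + c) ^ c) →
      (∃ (δ : ℕ) (μ : Nat.Partition (n * δ)) (D : ℕ) (F : Fin D → MvPolynomial (DegIdx (MatIdx n) n) ℂ)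
        (A : Fin D → Matrix (MatIdx n) (MatIdx n) ℂ) (U : Submodule ℂ (MatIdx (n + j) → ℂ)) (r : ℕ),
        μ.parts.card ≤ n * n ∧
        (∀ i, F i ∈ highestWeightSpace (coordRep (MatIdx n) ℂ n) (partitionWeightLex n μ)) ∧
        (Matrix.of fun i l : Fin D => MvPolynomial.aeval
            (fun e : DegIdx (MatIdx n) n =>
              (((e.1 (topMatIdx n) + j).descFactorial j : ℕ) : ℂ) *
                MvPolynomial.coeff e.1 (linSubst (MatIdx n) ℂ (A l) (paddedPerFormLex ℂ n n)))
            (F i)).det ≠ 0 ∧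
        (∀ u ∈ U, (Matrix.of fun a b : Fin (n + j) => u (toLex (a, b))).rank ≤ r) ∧
        Module.finrank ℂ ↥(MvPolynomial.homogeneousSubmodule (MatIdx (n + j) × MatIdx (n + j)) ℂ ((n + j) * δ) ⊓
            ((MvPolynomial.vanishingIdeal ℂ {p : MatIdx (n + j) × MatIdx (n + j) → ℂ | ∀ j' : MatIdx (n + j), (fun i => p (j', i)) ∈ U}) ^ (δ * ((n + j) - r))).restrictScalars ℂ ⊓
            (⨅ (M : Matrix (MatIdx (n + j)) (MatIdx (n + j)) ℂ) (_ : linSubst (MatIdx (n + j)) ℂ M (detFormLex ℂ (n + j)) = detFormLex ℂ (n + j)),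
              LinearMap.ker ((MvPolynomial.aeval (R := ℂ) fun p : MatIdx (n + j) × MatIdx (n + j) => ∑ l : MatIdx (n + j), M l p.2 • MvPolynomial.X (p.1, l)).toLinearMap -
                LinearMap.id (R := ℂ) (M := MvPolynomial (MatIdx (n + j) × MatIdx (n + j)) ℂ))) ⊓
            (⨅ (g : Matrix.GeneralLinearGroup (MatIdx (n + j)) ℂ) (_ : IsUpperTriangular g),
              LinearMap.ker ((MvPolynomial.aeval (R := ℂ) fun p : MatIdx (n + j) × MatIdx (n + j) => ∑ l : MatIdx (n + j), ((g⁻¹ : Matrix.GeneralLinearGroup (MatIdx (n + j)) ℂ) : Matrix (MatIdx (n + j)) (MatIdx (n + j)) ℂ) p.1 l • MvPolynomial.X (l, p.2)).toLinearMap -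
                weightChar (partitionWeightLex (n + j) (rowLift μ j)) g • LinearMap.id (R := ℂ) (M := MvPolynomial (MatIdx (n + j) × MatIdx (n + j)) ℂ)))) < D) ∨
      (∃ (δ : ℕ) (lam : Nat.Partition ((n + j) * δ)) (D : ℕ) (F : Fin D → MvPolynomial (DegIdx (MatIdx (n + j)) (n + j)) ℂ)
        (A : Fin D → Matrix (MatIdx (n + j)) (MatIdx (n + j)) ℂ) (U : Submodule ℂ (MatIdx (n + j) → ℂ)) (r : ℕ),
        lam.parts.card ≤ (n + j) * (n + j) ∧
        (∀ i, F i ∈ highestWeightSpace (coordRep (MatIdx (n + j)) ℂ (n + j)) (partitionWeightLex (n + j) lam)) ∧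
        (Matrix.of fun i l : Fin D => MvPolynomial.aeval
            (formCoeff (n + j) (linSubst (MatIdx (n + j)) ℂ (A l) (paddedPerFormLex ℂ n (n + j)))) (F i)).det ≠ 0 ∧
        (∀ u ∈ U, (Matrix.of fun a b : Fin (n + j) => u (toLex (a, b))).rank ≤ r) ∧
        Module.finrank ℂ ↥(MvPolynomial.homogeneousSubmodule (MatIdx (n + j) × MatIdx (n + j)) ℂ ((n + j) * δ) ⊓
            ((MvPolynomial.vanishingIdeal ℂ {p : MatIdx (n + j) × MatIdx (n + j) → ℂ | ∀ j' : MatIdx (n + j), (fun i => p (j', i)) ∈ U}) ^ (δ * ((n + j) - r))).restrictScalars ℂ ⊓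
            (⨅ (M : Matrix (MatIdx (n + j)) (MatIdx (n + j)) ℂ) (_ : linSubst (MatIdx (n + j)) ℂ M (detFormLex ℂ (n + j)) = detFormLex ℂ (n + j)),
              LinearMap.ker ((MvPolynomial.aeval (R := ℂ) fun p : MatIdx (n + j) × MatIdx (n + j) => ∑ l : MatIdx (n + j), M l p.2 • MvPolynomial.X (p.1, l)).toLinearMap -
                LinearMap.id (R := ℂ) (M := MvPolynomial (MatIdx (n + j) × MatIdx (n + j)) ℂ))) ⊓
            (⨅ (g : Matrix.GeneralLinearGroup (MatIdx (n + j)) ℂ) (_ : IsUpperTriangular g),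
              LinearMap.ker ((MvPolynomial.aeval (R := ℂ) fun p : MatIdx (n + j) × MatIdx (n + j) => ∑ l : MatIdx (n + j), ((g⁻¹ : Matrix.GeneralLinearGroup (MatIdx (n + j)) ℂ) : Matrix (MatIdx (n + j)) (MatIdx (n + j)) ℂ) p.1 l • MvPolynomial.X (l, p.2)).toLinearMap -
                weightChar (partitionWeightLex (n + j) lam) g • LinearMap.id (R := ℂ) (M := MvPolynomial (MatIdx (n + j) × MatIdx (n + j)) ℂ)))) < D)) :
    ∀ a b : ℕ, b < a → ∀ c : ℕ, ∃ n₀ : ℕ, ∀ n ≥ n₀, ∀ (m : ℕ) [NeZero m], a * n < b * m → m ≤ 2 ^ ((Nat.log 2 n + c) ^ c) →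
      ∃ (U : Submodule ℂ (MatIdx m → ℂ)) (r δ : ℕ) (lam : Nat.Partition (m * δ)), (∀ u ∈ U, (Matrix.of fun a b : Fin m => u (toLex (a, b))).rank ≤ r) ∧ lam.parts.card ≤ m * m ∧ (let χ : Weight (MatIdx m) := (Weight.dualOfPartition (m * m) lam).toMatIdx; let T : Submodule ℂ (MvPolynomial (MatIdx m × MatIdx m) ℂ) := MvPolynomial.homogeneousSubmodule (MatIdx m × MatIdx m) ℂ (m * δ) ⊓ ((MvPolynomial.vanishingIdeal ℂ {p : MatIdx m × MatIdx m → ℂ | ∀ j : MatIdx m, (fun i => p (j, i)) ∈ U}) ^ (δ * (m - r))).restrictScalars ℂ ⊓ (⨅ (M : Matrix (MatIdx m) (MatIdx m) ℂ) (_ : linSubst (MatIdx m) ℂ M (detFormLex ℂ m) = detFormLex ℂ m), LinearMap.ker ((MvPolynomial.aeval (R := ℂ) fun p : MatIdx m × MatIdx m => ∑ l : MatIdx m, M l p.2 • MvPolynomial.X (p.1, l)).toLinearMap - LinearMap.id (R := ℂ) (M := MvPolynomial (MatIdx m × MatIdx m) ℂ))) ⊓ (⨅ (g : Matrix.GeneralLinearGroup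 (MatIdx m) ℂ) (_ : IsUpperTriangular g), LinearMap.ker ((MvPolynomial.aeval (R := ℂ) fun p : MatIdx m × MatIdx m => ∑ l : MatIdx m, ((g⁻¹ : Matrix.GeneralLinearGroup (MatIdx m) ℂ) : Matrix (MatIdx m) (MatIdx m) ℂ) p.1 l • MvPolynomial.X (l, p.2)).toLinearMap - weightChar χ g • LinearMap.id (R := ℂ) (M := MvPolynomial (MatIdx m × MatIdx m) ℂ))); Module.finrank ℂ ↥T < orbitMultiplicity ℂ (paddedPerFormLex ℂ n m) m χ) := by
  intro a b hba c
  obtain ⟨n₀, hn₀⟩ := hC a b hba c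
  refine ⟨max n₀ 1, fun n hn m _ hlt hm => ?_⟩
  have hn0 : n₀ ≤ n := le_of_max_le_left hn
  have hn1 : 1 ≤ n := le_of_max_le_right hn
  have hnm : n < m := lt_of_slope hba hlt
  obtain ⟨j, rfl⟩ : ∃ j, m = n + j := ⟨m - n, by omega⟩
  haveI : NeZero n := ⟨by omega⟩
  rcases hn₀ n hn0 j hlt hm with ⟨δ, μ, D, F, A, U, r, hμ, hF, hdet, hU, hcensus⟩ |
      ⟨δ, lam, D, F, A, U, r, hlam, hF, hdet, hU, hcensus⟩
  · have hD := hB n j δ μ hμ D F hF A hdet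
    refine ⟨U, r, δ, rowLift μ j, hU, ?_, ?_⟩
    · exact (card_parts_rowLift_le μ j).trans (max_le (hμ.trans (Nat.mul_le_mul (Nat.le_add_right n j) (Nat.le_add_right n j))) (Nat.one_le_iff_ne_zero.2 (mul_ne_zero (NeZero.ne (n + j)) (NeZero.ne (n + j)))))
    · intro χ T
      exact lt_of_lt_of_le hcensus hD
  · have hD := hA (paddedPerFormLex ℂ n (n + j)) (n + j) (NeZero.ne (n + j)) (partitionWeightLex (n + j) lam) D F hF A hdet
    refine ⟨U, r, δ, lam, hU, hlam, ?_⟩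
    intro χ T
    exact lt_of_lt_of_le hcensus hD

/-- **The crux from the stubs**: `ValuativeGCT.ValuativeFlip` BY NAME from the head (slope `6/5`,
line `four-row-count`) and the tail (`stub_evalRankLowerBound`, `stub_twistedInheritance`,
`stub_tailCertificates`), glued by the case split on `5·m ≤ 6·n` exactly as `Split.lean`'s
`ValuativeFlip_of_subs`.  Sorry-free over the four stubs. [this file; Split.lean] -/
theorem ValuativeFlip_of :
    Summit.ValiantsHypothesis.ValiantsHypothesis.Theses.ValuativeGCT.ValuativeFlip := by
  have hHead := stub_headFlip
  have hTail := tailFlip_of_certificates stub_evalRankLowerBound stub_twistedInheritance stub_tailCertificates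
  obtain ⟨n₁, hH⟩ := hHead
  intro c
  obtain ⟨n₂, hT⟩ := hTail 6 5 (by norm_num) c
  refine ⟨max n₁ n₂, fun n hn m _ hnm hm => ?_⟩
  have hn₁ : n₁ ≤ n := le_of_max_le_left hn
  have hn₂ : n₂ ≤ n := le_of_max_le_right hn
  by_cases hcase : 5 * m ≤ 6 * n
  · exact hH n hn₁ m hnm hcase
  · exact hT n hn₂ m (Nat.lt_of_not_le hcase) hm

end

end Summit.ValiantsHypothesis.ValiantsHypothesis.Cruxes.ValuativeFlip.SiegeStubs
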